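import Mathlib
import Summits.Ventures.PercRepro2.TypedORootEdge
import Summits.Ventures.PercRepro2.TypedOEdgeTypeTwo

/-!
# The root edge at a degree-two `o`: the type-1 count is the sum of the deleted and the type-2
counts (blind cell PercRepro2, night-3 g17, 2026-08-27; NIGHT3-CERT.md §26.6)

For the kernel `K₃` of (HCOV), with `e = {o, u}` of type `1` and `f = {o, a₁}` the only typed edges
at `o` (the others pinned closed and untyped): the count with `f` pinned open vanishes
(`typedCount_o_root_open`: `o = a₁` in every copy), so the identity
«type 2 = type 1 + pinned open − deleted» at `f` (`typedCount_o_edge_type_two`) reads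

  `N(τ[f := 1]) = N(τ[f := 0]) + N(τ[f := 2])`   (`typedCount_o_root_edge_split`).

Hence row 2′TRI at the `(1, 1)` instance follows from row 2′TRI at the `(1, 0)` instance (`o`
pendant at `u`, a smaller instance: `o := u`) and at the `(1, 2)` instance
(`typedCount_nonneg_o_root_of_two`), and with `typedCount_o_root_edge` the double class is
`D₂ = N(τ[f := 2]) − N(τ[f := 0])`: the sharp lower bound on the double class at this attachment is
`D₂ ≥ −N(F ∖ f)`, not `−2·N(F ∖ f)` — it is the `(1, 2)` typed base (`doubleClass_eq_two_sub`).
Along the weight of `f` (the rest typed) the cubic form is `(1 − t)·[N(τ[f := 0])(1 − t) +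
N(τ[f := 2])·t]`: linear after the factor, its positivity is exactly these two counts.  Own work;
standard axioms.
-/

namespace Summit.Ventures.PercRepro2

namespace CovForm

namespace TypedRed

open OneTyped Contract TypedVanish

section Main

open Classical

variable {V : Type*} {E : Type*} [Fintype E] [DecidableEq E] {R : Type*} [Field R]
  [LinearOrder R] [IsStrictOrderedRing R]

variable (ends : E → Sym2 V) (o a₁ a₂ a₃ b : V)

/-- **A root edge pinned open kills the count**: with `f = {o, a₁}` of type `3` (open in every
copy) the typed count vanishes whatever the other typed edges — `o = a₁` in every copy. -/
theorem typedCount_o_root_open {f : E} (hf : ends f = s(o, a₁)) (F : Finset E) (hfF : f ∈ F)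
    (z : Config E) (τ : E → ℕ) (hτ : τ f = 3) :
    typedCount F z τ (K3 ends o a₁ a₂ a₃ b : Config E → Config E → Config E → R) = 0 := by
  rw [typedCount_type_three F f hfF z τ hτ]
  have hf' : ends f = s(a₁, o) := by rw [hf, Sym2.eq_swap]
  rw [typedCount_contract_open ends o a₁ a₂ a₃ b hf' (F.erase f) (Finset.notMem_erase f F)
    (Function.update z f true) (by simp) τ]
  rw [contractMap_of_mem (by simp : o ∈ ({a₁, o} : Finset V)),
    contractMap_of_mem (by simp : a₁ ∈ ({a₁, o} : Finset V)), typedCount_eq_zero_of_o_eq_a1]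

/-- **The split at the root edge**: with `e` (of type `1`) the only other typed edge at `o` — any
edge, at `o` or elsewhere — `N(τ[f := 1]) = N(τ[f := 0]) + N(τ[f := 2])`. -/
theorem typedCount_o_root_edge_split {e f : E} (hf : ends f = s(o, a₁)) (hef : e ≠ f)
    (ho1 : o ≠ a₁) (ho2 : o ≠ a₂) (ho3 : o ≠ a₃) (hob : o ≠ b) (F : Finset E) (heF : e ∈ F)
    (hfF : f ∈ F) (z : Config E) (τ : E → ℕ) (hτe : τ e = 1)
    (hcl : ∀ e', e' ≠ e → e' ≠ f → o ∈ ends e' → e' ∉ F ∧ z e' = false) :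
    typedCount F z (Function.update τ f 1)
        (K3 ends o a₁ a₂ a₃ b : Config E → Config E → Config E → R) =
      typedCount F z (Function.update τ f 0) (K3 ends o a₁ a₂ a₃ b) +
        typedCount F z (Function.update τ f 2) (K3 ends o a₁ a₂ a₃ b) := by
  have hcl' : ∀ e', e' ≠ f → e' ≠ e → o ∈ ends e' → e' ∉ F ∧ z e' = false :=
    fun e' h1 h2 h3 => hcl e' h2 h1 h3
  have h := typedCount_o_edge_type_two (R := R) ends o a₁ a₂ a₃ b (e := f) (f := e) (u := a₁) hf ho1
    hef.symm ho1 ho2 ho3 hob F hfF heF z τ hτe hcl'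
  rw [typedCount_o_root_open ends o a₁ a₂ a₃ b hf F hfF z _ (Function.update_self _ _ _)] at h
  linarith

/-- **Row 2′TRI at the `(1, 1)` instance from the `(1, 0)` and `(1, 2)` instances.** -/
theorem typedCount_nonneg_o_root_of_two {e f : E} (hf : ends f = s(o, a₁)) (hef : e ≠ f)
    (ho1 : o ≠ a₁) (ho2 : o ≠ a₂) (ho3 : o ≠ a₃) (hob : o ≠ b) (F : Finset E) (heF : e ∈ F)
    (hfF : f ∈ F) (z : Config E) (τ : E → ℕ) (hτe : τ e = 1)
    (hcl : ∀ e', e' ≠ e → e' ≠ f → o ∈ ends e' → e' ∉ F ∧ z e' = false)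
    (h0 : 0 ≤ typedCount F z (Function.update τ f 0)
      (K3 ends o a₁ a₂ a₃ b : Config E → Config E → Config E → R))
    (h2 : 0 ≤ typedCount F z (Function.update τ f 2)
      (K3 ends o a₁ a₂ a₃ b : Config E → Config E → Config E → R)) :
    0 ≤ typedCount F z (Function.update τ f 1)
      (K3 ends o a₁ a₂ a₃ b : Config E → Config E → Config E → R) := by
  rw [typedCount_o_root_edge_split ends o a₁ a₂ a₃ b hf hef ho1 ho2 ho3 hob F heF hfF z τ hτe hcl]
  exact add_nonneg h0 h2

/-- **The double class is the `(1, 2)` count minus the deleted count**: at `e = {o, u}`,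
`f = {o, a₁}` of types `(1, 1)`, `D₂ = N(τ[f := 2]) − N(τ[f := 0])`. -/
theorem doubleClass_eq_two_sub {e f : E} {u : V} (he : ends e = s(o, u))
    (hf : ends f = s(o, a₁)) (hou : o ≠ u) (hef : e ≠ f) (ho1 : o ≠ a₁) (ho2 : o ≠ a₂)
    (ho3 : o ≠ a₃) (hob : o ≠ b) (F : Finset E) (heF : e ∈ F) (hfF : f ∈ F) (z : Config E)
    (τ : E → ℕ) (hτe : τ e = 1) (hτf : τ f = 1)
    (hcl : ∀ e', e' ≠ e → e' ≠ f → o ∈ ends e' → e' ∉ F ∧ z e' = false) :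
    doubleClass F z τ e f (K3 ends o a₁ a₂ a₃ b : Config E → Config E → Config E → R) =
      typedCount F z (Function.update τ f 2) (K3 ends o a₁ a₂ a₃ b) -
        typedCount F z (Function.update τ f 0) (K3 ends o a₁ a₂ a₃ b) := by
  have h1 := typedCount_o_root_edge (R := R) ends o a₁ a₂ a₃ b he hf hou hef ho1 ho2 ho3 hob F heF
    hfF z τ hτe hτf hcl
  have h2 := typedCount_o_root_edge_split (R := R) ends o a₁ a₂ a₃ b hf hef ho1 ho2 ho3 hob F heF
    hfF z τ hτe hcl
  have hτ1 : Function.update τ f 1 = τ := by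
    rw [← hτf]; exact Function.update_eq_self f τ
  rw [hτ1] at h2
  have h0 : typedCount F z (Function.update τ f 0)
      (K3 ends o a₁ a₂ a₃ b : Config E → Config E → Config E → R) =
      typedCount (F.erase f) (Function.update z f false) τ (K3 ends o a₁ a₂ a₃ b) := by
    rw [typedCount_type_zero F f hfF z _ (Function.update_self _ _ _)]
    exact typedCount_congr_τ (F.erase f) _
      (fun e' he' => Function.update_of_ne (Finset.ne_of_mem_erase he') _ _) _
  rw [h0] at h2
  linarith

end Main

end TypedRed

end CovForm

end Summit.Ventures.PercRepro2
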